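import Summits.Schanuel.Schanuel.Theorems.SoloInformedAPIntegrality

/-!
# Lemma AE₃ (kernel form): inexact 3-term progressions among served roots are expensive

Soloist file (informed mode, seat `solo-Schanuel-informed`, s182).  The dictionary from SERVED
ROOTS to the 3-AP integrality core `SoloInformedAPIntegrality`, parallel to
`SoloInformedLemmaAE` (which did the same for additive quadruples and the equation of squared
differences).

Setting (`soloAP_lemmaAE3`).  `F : ℤ[X]`, `F ≠ 0`, `natDegree F = D`, complex roots enumerated
with multiplicity by `ρ : Fin D → ℂ`; `ξ η : ℂ`, `0 < ε`; a finset `S` of naturals is SERVED: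
`ι : ℕ → Fin D` is injective on `S` and `‖ρ (ι s) − (s ξ + η)‖ ≤ ε` for `s ∈ S`.  An (ordered)
INEXACT PROGRESSION is a triple `c = (s₁, s₂, s₃)` of elements of `S` with `s₁ + s₃ = 2 s₂` and
`ρ (ι s₁) + ρ (ι s₃) ≠ 2 ρ (ι s₂)` (which forces `s₁ ≠ s₃`).  For ANY finset `𝒜` of such
triples, with `M` the Mahler measure of `F` over `ℂ`:

  `#𝒜 · log (1/(4ε)) ≤ 3 D² · log M + D³ · log 4`.

(No upper bound on `ε`, no hypothesis on `ξ`, no range `K` is needed: the defect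
`ρ (ι s₁) + ρ (ι s₃) − 2 ρ (ι s₂)` of a served progression has norm `≤ 4ε` identically, whereas
a served additive quadruple only gives `‖d₁² − d₂²‖ ≤ 8 (K‖ξ‖+1) ε`.)  Both orientations
`(s₁, s₂, s₃)`, `(s₃, s₂, s₁)` of a progression may be put in `𝒜`, so a family of `N₃`
unordered inexact progressions costs `2 N₃ · log(1/(4ε)) ≤ 3 D² log M + D³ log 4`.

Contents (prefix `soloAP_`):
* `soloAP_served_defect_le` — three served points in progression: `‖r s₁ + r s₃ − 2 r s₂‖ ≤ 4ε`;
* `soloAP_lemmaAE3` — the lemma: the root-triple map `c ↦ (ι s₁, ι s₂, ι s₃)` is injective on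
  `𝒜` and lands in the finset `T` of triples `t` with `L t ≠ 0`, `‖L t‖ ≤ 4ε`
  (`L t = ρ t.1 + ρ t.2.2 − 2 ρ t.2.1`), so `#𝒜 ≤ #T` and `soloAP_card_mul_log_le` bounds
  `#T · log(1/(4ε))`; if `4ε > 1` the left side is `≤ 0 ≤` the right side (`M ≥ 1`).

What this is NOT.  One input of the seat's pen-and-paper sharpening AE₃-1 (`ν > 3 + β − 3σ`
in place of AE-1's `ν > 4 + β − 4σ`) of its partial results on the toy node
`RoyAdditiveDirichletExponent` ([cite: Roy2010, Thm 1.1]); the robust 3-AP rigidity and the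
assembly are separate files, and nothing here bears on `Literature.Periods.SchanuelConjecture`
(the seat's verdict, no path, is unchanged).  Elementary, claimed by no one as new
([cite: Baker1975, Ch. 8 §3, p. 84] for the integrality device); Mathlib-only apart from the
imported seat files; no literature hypothesis; axioms the standard three.
-/

namespace Summit.Schanuel.Schanuel.Theorems

open Finset

section Progressions

variable {D : ℕ}

/-- Three served points in arithmetic progression: the defect has norm `≤ 4 ε`. -/
theorem soloAP_served_defect_le (r : ℕ → ℂ) (ξ η : ℂ) {ε : ℝ} {s₁ s₂ s₃ : ℕ}
    (h₁ : ‖r s₁ - (s₁ * ξ + η)‖ ≤ ε) (h₂ : ‖r s₂ - (s₂ * ξ + η)‖ ≤ ε)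
    (h₃ : ‖r s₃ - (s₃ * ξ + η)‖ ≤ ε) (hAP : s₁ + s₃ = 2 * s₂) :
    ‖r s₁ + r s₃ - 2 * r s₂‖ ≤ 4 * ε := by
  have hc : (s₁ : ℂ) + s₃ = 2 * s₂ := by exact_mod_cast hAP
  have : r s₁ + r s₃ - 2 * r s₂ =
      (r s₁ - (s₁ * ξ + η)) + (r s₃ - (s₃ * ξ + η)) - 2 * (r s₂ - (s₂ * ξ + η)) := by
    linear_combination ξ * hc
  rw [this]
  calc ‖(r s₁ - (s₁ * ξ + η)) + (r s₃ - (s₃ * ξ + η)) - 2 * (r s₂ - (s₂ * ξ + η))‖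
      ≤ ‖(r s₁ - (s₁ * ξ + η)) + (r s₃ - (s₃ * ξ + η))‖ + ‖2 * (r s₂ - (s₂ * ξ + η))‖ :=
        norm_sub_le _ _
    _ ≤ ε + ε + 2 * ε := by
        rw [norm_mul, Complex.norm_two]
        linarith [norm_add_le (r s₁ - (s₁ * ξ + η)) (r s₃ - (s₃ * ξ + η))]
    _ = 4 * ε := by ring

/-- **LEMMA AE₃ (kernel form).**  Setting: `F ∈ ℤ[X]` non-zero with `natDegree F = D`, roots
`ρ` (enumerated with multiplicity); `ξ, η ∈ ℂ`, `0 < ε`; a finset `S` of naturals SERVED by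
roots via `ι` (injective on `S`, `‖ρ (ι s) − (s ξ + η)‖ ≤ ε`).  Let `𝒜` be any finset of
ORDERED inexact progressions `c = (s₁, s₂, s₃)`: all `sᵢ ∈ S`, `s₁ + s₃ = 2 s₂` and
`ρ (ι s₁) + ρ (ι s₃) ≠ 2 ρ (ι s₂)`.  Then, with `M` the Mahler measure of `F` over `ℂ`,
`#𝒜 · log (1/(4ε)) ≤ 3 D² · log M + D³ · log 4`. -/
theorem soloAP_lemmaAE3 (F : Polynomial ℤ) (hF : F ≠ 0) (hD : F.natDegree = D)
    (ρ : Fin D → ℂ) (hρ : univ.val.map ρ = (F.map (Int.castRingHom ℂ)).roots)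
    (ξ η : ℂ) {ε : ℝ} (hε0 : 0 < ε)
    (S : Finset ℕ) (ι : ℕ → Fin D) (hι : Set.InjOn ι S)
    (hserved : ∀ s ∈ S, ‖ρ (ι s) - (s * ξ + η)‖ ≤ ε)
    (𝒜 : Finset (ℕ × ℕ × ℕ))
    (hS : ∀ c ∈ 𝒜, c.1 ∈ S ∧ c.2.1 ∈ S ∧ c.2.2 ∈ S)
    (hAP : ∀ c ∈ 𝒜, c.1 + c.2.2 = 2 * c.2.1)
    (hinex : ∀ c ∈ 𝒜, ρ (ι c.1) + ρ (ι c.2.2) ≠ 2 * ρ (ι c.2.1)) :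
    (#𝒜 : ℝ) * Real.log (1 / (4 * ε)) ≤
      ((3 * D ^ 2 : ℕ) : ℝ) * Real.log (F.map (Int.castRingHom ℂ)).mahlerMeasure
        + ((D ^ 3 : ℕ) : ℝ) * Real.log 4 := by
  classical
  -- the linear-form values and the target finset of root triples
  obtain ⟨L, hL⟩ : ∃ L : Fin D × Fin D × Fin D → ℂ,
      ∀ t, L t = ρ t.1 + ρ t.2.2 - 2 * ρ t.2.1 := ⟨_, fun _ => rfl⟩
  have hε' : 0 < 4 * ε := by positivity
  obtain ⟨T, hT⟩ : ∃ T : Finset (Fin D × Fin D × Fin D),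
      T = univ.filter (fun t => ∃ c ∈ 𝒜, t = (ι c.1, ι c.2.1, ι c.2.2)) := ⟨_, rfl⟩
  -- each progression: the estimate
  have hest : ∀ c ∈ 𝒜, L (ι c.1, ι c.2.1, ι c.2.2) ≠ 0 ∧
      ‖L (ι c.1, ι c.2.1, ι c.2.2)‖ ≤ 4 * ε := by
    intro c hc
    obtain ⟨h1, h2, h3⟩ := hS c hc
    simp only [hL]
    refine ⟨fun h => hinex c hc (sub_eq_zero.mp h), ?_⟩
    exact soloAP_served_defect_le (fun s => ρ (ι s)) ξ η (hserved _ h1) (hserved _ h2)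
      (hserved _ h3) (hAP c hc)
  -- `T` qualifies for the analytic core
  have hTok : ∀ t ∈ T, L t ≠ 0 ∧ ‖L t‖ ≤ 4 * ε := by
    intro t ht
    rw [hT, Finset.mem_filter] at ht
    obtain ⟨c, hc, rfl⟩ := ht.2
    exact hest c hc
  -- `#𝒜 ≤ #T`: the root-triple map is injective on `𝒜` and lands in `T`
  have hcard : #𝒜 ≤ #T := by
    have hinj : Set.InjOn (fun c : ℕ × ℕ × ℕ => (ι c.1, ι c.2.1, ι c.2.2)) ↑𝒜 := by
      intro c hc c' hc' h
      simp only [Prod.mk.injEq] at h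
      obtain ⟨h1, h2, h3⟩ := hS c hc
      obtain ⟨h1', h2', h3'⟩ := hS c' hc'
      exact Prod.ext (hι h1 h1' h.1) (Prod.ext (hι h2 h2' h.2.1) (hι h3 h3' h.2.2))
    have himg : 𝒜.image (fun c : ℕ × ℕ × ℕ => (ι c.1, ι c.2.1, ι c.2.2)) ⊆ T := by
      intro t ht
      rw [Finset.mem_image] at ht
      obtain ⟨c, hc, rfl⟩ := ht
      rw [hT, Finset.mem_filter]
      exact ⟨Finset.mem_univ _, c, hc, rfl⟩
    calc #𝒜 = #(𝒜.image (fun c : ℕ × ℕ × ℕ => (ι c.1, ι c.2.1, ι c.2.2))) :=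
          (Finset.card_image_of_injOn hinj).symm
      _ ≤ #T := Finset.card_le_card himg
  -- the analytic core for `T`, then pass from `#T` to `#𝒜`
  have hcore := soloAP_card_mul_log_le F hF hD ρ hρ L hL hε' T hTok
  have hMge : 1 ≤ (F.map (Int.castRingHom ℂ)).mahlerMeasure := by
    refine Polynomial.one_le_mahlerMeasure_of_one_le_norm_leadingCoeff ?_
    rw [Polynomial.leadingCoeff_map_of_injective (Int.castRingHom ℂ).injective_int,
      eq_intCast, Complex.norm_intCast]
    exact_mod_cast Int.one_le_abs (Polynomial.leadingCoeff_ne_zero.mpr hF)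
  have hRHS : 0 ≤ ((3 * D ^ 2 : ℕ) : ℝ) * Real.log (F.map (Int.castRingHom ℂ)).mahlerMeasure
      + ((D ^ 3 : ℕ) : ℝ) * Real.log 4 := by
    have := Real.log_nonneg hMge
    have : 0 < Real.log 4 := Real.log_pos (by norm_num)
    positivity
  by_cases hlog : 0 ≤ Real.log (1 / (4 * ε))
  · exact (mul_le_mul_of_nonneg_right (by exact_mod_cast hcard) hlog).trans hcore
  · exact (mul_nonpos_iff.mpr (Or.inl ⟨Nat.cast_nonneg _, (not_le.mp hlog).le⟩)).trans hRHS

end Progressions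

end Summit.Schanuel.Schanuel.Theorems
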